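import Summits.AtomisticToContinuum.HydrodynamicLimit.Theorems.CollisionIsometryCLTDiffuseBackwardInfluenceLateMergesRare
import Summits.AtomisticToContinuum.HydrodynamicLimit.Theorems.CollisionIsometryCLTDiffuseBackwardInfluenceRowBudgetN
import Summits.AtomisticToContinuum.HydrodynamicLimit.Theorems.CollisionIsometryCLTDiffuseBackwardInfluenceOnePathPotentials

/-!
# `DiffuseBackwardInfluence`, line `share-nondegeneracy-one-flight`: what the late-contact stub really asks —
domination by the crux-with-a-rate, the split charge, and the bootstrap that replaces it
(stub `stub_lateTouchRare` of crux stmt-AtomisticToContinuum-12950; support file, registered sub-goals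
`lateTouchRare_of_lateCoinRareAt`, `lateSplit_charge` — a SIZE VERDICT with its formal core, not a proof of the stub)

The registered stub `stub_lateTouchRare : LateMerges.LateTouchRare` (late host–host CONTACTS of the two influence
tracers of a uniform source are rare along the local-Gibbs-evolved law, `…LateMergesRare.lean` §3) is TRUE-but-not-
separable: at fixed `σ` it is equivalent in size to a RATE form of the crux it is meant to help prove. This file makes
that precise and lands the pathwise half of the repair. Vocabulary: `μ_src(i) = a_{i,src}/3` (law of one tracer),
`P_i(n) := Σ_src μ_src(i)² = K_ii(n)/9` (`rowPart`; `ipr = 9·mean_i P_i`, `ipr_eq_rowPart`), reflected pair `(p_k, q_k)`.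

1. **Upper side (`§1`, proved): contacts ≤ coincidences.** `touchAt = 2μ(p)μ(q) ≤ μ(p)² + μ(q)² =: coinAt` source by
   source (AM–GM, `touchAt_le_coinAt`; Cauchy–Schwarz form `(Σ_src touchAt)² ≤ 4 P_p P_q`, `sum_touchAt_sq_le`,
   `kinship_sq_le`), hence `lateTouchFr ≤ lateCoinFr = (N+1)⁻¹ Σ_{late k} (P_{p_k}(k) + P_{q_k}(k))`
   (`lateTouchFr_le_lateCoinFr`, `lateCoinFr_eq_sum_rowPart`) and `LateCoinRareAt ⇒ LateTouchRareAt` (`§3`, registered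
   sub-goal `lateTouchRare_of_lateCoinRareAt`). `lateCoinFr` is the crux's own functional SUMMED over the `≍ n_N/L → ∞`
   late collisions of each particle (`P_i ∈ [1/(N+1), 1]` under `RowBudgetN`, `rowPart_le_one`: same scale as
   `lateTouchFr`), so `LateCoinRare` says `≈ (n_N/L)·E[ipr_late]/9 → 0`: the crux WITH A RATE (`E[ipr](n) = O(9/n)`
   collisions-per-particle deep, N-uniformly) — predicted true (`E[ipr] ≈ 9(Ae^{−0.3n} + Bσ⁶n^{−3/2}) + O(9/N)`, card
   `coalescing-influence-tracers`, Disproof §8 MD), but STRONGER than the crux.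
2. **Lower side (dynamics, informal — why the stub is not smaller than that).** A parting of the two tracers at an
   `η`-non-degenerate `(p,q)`-contact followed by a PROMPT ring re-collision of the hosts carrying them is a contact;
   its multiplicity `r(σ) ≍ σ³ > 0` is `N`-uniform at fixed `σ`. So `E[lateTouchFr_L] ≳ r(σ)·E[lateSplitFr_L on ND
   steps]` with `splitAt = 2f_p(1−f_p)μ(p)² + 2f_q(1−f_q)μ(q)² ≥ 2η(1−η)·coinAt` there: up to the constants
   `2η(1−η) r(σ)` and the degenerate steps, `LateTouchRare ⇔ LateCoinRare`. Circular as a decomposition.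
3. **The way out (`§2`, proved): THE SPLIT CHARGE.** Exact two-tracer bookkeeping from the exchange rule
   (`OnePath.mu_succ_fst/snd`): `together(n+1) = together(n) − splitAt(n) + mergeAt(n)` per source (`together_succ`),
   telescoped (`sum_splitAt_eq`) and averaged: `lateSplitFr(Δ,L) ≤ ipr((1−1/L)Δ)/9 + lateMergeFr(Δ,L) ≤ ipr((1−1/L)Δ)/9
   + lateTouchFr(Δ,L)` for EVERY configuration (`lateSplitFr_le`, registered sub-goal `lateSplit_charge`). Late partings
   are paid by coincidence at the START of the late window — the crux functional one depth earlier, on the admissible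
   window `(1−1/L)Δ_N`, with NO rate — plus late merges (and trivially split ≤ coincidence/2, `2f(1−f) ≤ 1/2`).
4. **The re-lined decomposition this supports** (for the lead; concrete two-path signatures ELABORATED in the evidence
   file `LateTouchPaths.lean` on the item). Split every contact by the lag since the LAST ENCOUNTER (together, or on
   colliding hosts) of the two tracers — a two-tracer PATH variable (product of the one-tracer kernels built from
   `shareFrac`; template `OnePath.pot`/`transport` with a lag counter), NOT a function of the marginals `μ`:
   `lateTouchFr = latePromptFr_R + lateFreshFr_R`. Dynamical inputs: (P) `PromptRetouchBound` — `E[latePromptFr_R] ≤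
   r(σ)·E[encounter-ends feeding it] (≤ lateSplitFr + lateTouchFr on the last 2/L, + R-slow tracers)`, `r(σ) ≤ 1/8` for
   `σ < σ₀`, every `R` (bounded-depth ring re-collision multiplicity `≍ σ³`: THE place smallness of `σ` is load-bearing);
   (F) `FreshTouchRare` — `∀ ε ∃ R`, `E[lateFreshFr_R] ≤ ε` eventually (pair transience in `d = 3`). With `K, S, T'` the
   limsups of `E[lateTouchFr_L]`, `E[lateSplitFr_L]`, `E[ipr((1−1/L)Δ_N)]/9`: `K ≤ r(S + K) + F`, `S ≤ T' + K` (item 3),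
   so `K(1−2r) ≤ rT' + F`; `OnePathBound` gives `limsup E[ipr(Δ_N)] ≤ a(m,η,b) + 9K`; hence `Λ := sup_{admissible Δ}
   limsup_N E[ipr] ≤ 9` obeys `Λ ≤ a + (rΛ + 9F)/(1−2r)` and `bootstrap_le` closes it for `3r < 1`: the composition
   becomes a bootstrap over depth (any fixed `L ≥ 2`), and no stub hides a rate.

Nothing is assumed: `LateCoinRareAt`/`LateCoinRare` are predicates, consumed only as explicit hypotheses.
-/

namespace Summit.AtomisticToContinuum.HydrodynamicLimit.Theorems.DiffuseBackwardInfluenceShare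

open scoped BigOperators Topology ENNReal InnerProductSpace Classical
open Filter Set MeasureTheory
open Literature.Analysis.FluidPDE (Config HardSphereFlow collidePair)
open Literature.MathematicalPhysics.KineticTheory (localGibbsLaw hsDiameter)
open Summit.AtomisticToContinuum.HydrodynamicLimit.Theorems.DiffuseBackwardInfluenceNeg

noncomputable section

namespace LateMerges

/-! ## §1 Coincidence mass: the AM–GM / Cauchy–Schwarz domination `touchAt ≤ coinAt` -/
section Coin

variable (σ : ℝ) (N : ℕ)

/-- ROW PARTICIPATION IN TRACER UNITS after `n` fold steps: `P_i(n) := Σ_src (a_{i,src}(n)/3)² = K_ii(n)/9`, the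
probability (density per source) that the two conditionally independent tracers of a uniform source both sit on host
`i`; `ipr(Δ) = 9 (N+1)⁻¹ Σ_i P_i(colls Δ)` (`ipr_eq_rowPart`). -/
def rowPart (y : Cfg N) (n : ℕ) (i : Fin (N + 1)) : ℝ :=
  ∑ src : Fin (N + 1), (blockMass σ N y n i src / 3) ^ 2

/-- COINCIDENCE MASS of the two tracers of source `src` at fold step `k`: `μ(p)² + μ(q)²` at the reflected pair
`(p, q)` — the probability that the two tracers sit TOGETHER on one of the two endpoints of collision `k` just before
it (`0` if the step reflects nothing). -/
def coinAt (y : Cfg N) (src : Fin (N + 1)) (k : ℕ) : ℝ :=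
  if h : (pairsAt σ N y k).Nonempty then
    (blockMass σ N y k h.some.1 src / 3) ^ 2 + (blockMass σ N y k h.some.2 src / 3) ^ 2
  else 0

/-- LATE COINCIDENCE MASS: source-averaged coincidence mass over the late fold steps — the expected number of late
collisions suffered by the common host of the two tracers of a uniform source while they are together;
`= (N+1)⁻¹ Σ_{late k} (P_{p_k}(k) + P_{q_k}(k))` (`lateCoinFr_eq_sum_rowPart`). -/
def lateCoinFr (y : Cfg N) (Δ : ℝ) (L : ℕ) : ℝ :=
  ((N + 1 : ℕ) : ℝ)⁻¹ * ∑ src : Fin (N + 1),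
    ∑ k ∈ Finset.Ico (colls σ N y ((1 - 1 / (L : ℝ)) * Δ)) (colls σ N y Δ), coinAt σ N y src k

variable {σ N}

/-- Coincidence masses vanish at steps that reflect nothing. [folklore] -/
theorem coinAt_of_not_nonempty {y : Cfg N} {k : ℕ} (h : ¬ (pairsAt σ N y k).Nonempty) (src : Fin (N + 1)) :
    coinAt σ N y src k = 0 := by
  unfold coinAt; rw [dif_neg h]

/-- Coincidence masses at a reflecting step, unfolded. [folklore] -/
theorem coinAt_of_nonempty {y : Cfg N} {k : ℕ} (h : (pairsAt σ N y k).Nonempty) (src : Fin (N + 1)) :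
    coinAt σ N y src k = (blockMass σ N y k h.some.1 src / 3) ^ 2 + (blockMass σ N y k h.some.2 src / 3) ^ 2 := by
  unfold coinAt; rw [dif_pos h]

/-- Coincidence masses are nonnegative. [folklore] -/
theorem coinAt_nonneg (y : Cfg N) (src : Fin (N + 1)) (k : ℕ) : 0 ≤ coinAt σ N y src k := by
  by_cases h : (pairsAt σ N y k).Nonempty
  · rw [coinAt_of_nonempty h]; positivity
  · rw [coinAt_of_not_nonempty h]

/-- **AM–GM: contacts are dominated by coincidences, `touchAt ≤ coinAt`** (`2μ(p)μ(q) ≤ μ(p)² + μ(q)²`), source by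
source, with no row budget. [folklore] -/
theorem touchAt_le_coinAt (y : Cfg N) (src : Fin (N + 1)) (k : ℕ) : touchAt σ N y src k ≤ coinAt σ N y src k := by
  by_cases h : (pairsAt σ N y k).Nonempty
  · rw [touchAt_of_nonempty h, coinAt_of_nonempty h]
    nlinarith [sq_nonneg (blockMass σ N y k h.some.1 src / 3 - blockMass σ N y k h.some.2 src / 3)]
  · rw [touchAt_of_not_nonempty h, coinAt_of_not_nonempty h]

/-- Late coincidence masses are nonnegative. [folklore] -/
theorem lateCoinFr_nonneg (y : Cfg N) (Δ : ℝ) (L : ℕ) : 0 ≤ lateCoinFr σ N y Δ L := by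
  unfold lateCoinFr
  exact mul_nonneg (inv_nonneg.2 (by positivity)) (Finset.sum_nonneg fun s _ => Finset.sum_nonneg fun k _ => coinAt_nonneg y s k)

/-- **`lateTouchFr ≤ lateCoinFr`** pointwise, for every configuration, window and `L`. [folklore] -/
theorem lateTouchFr_le_lateCoinFr (y : Cfg N) (Δ : ℝ) (L : ℕ) : lateTouchFr σ N y Δ L ≤ lateCoinFr σ N y Δ L := by
  unfold lateTouchFr lateCoinFr
  refine mul_le_mul_of_nonneg_left ?_ (inv_nonneg.2 (by positivity))
  exact Finset.sum_le_sum fun src _ => Finset.sum_le_sum fun k _ => touchAt_le_coinAt y src k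

/-- `rowPart = K_ii / 9`. [folklore] -/
theorem rowPart_eq_kinship (y : Cfg N) (n : ℕ) (i : Fin (N + 1)) : rowPart σ N y n i = kinship σ N y n i i / 9 := by
  unfold rowPart kinship
  rw [Finset.sum_div]
  exact Finset.sum_congr rfl fun src _ => by ring

/-- Summed over the sources, the coincidence mass of step `k` is `P_p(k) + P_q(k)` at the reflected pair. [folklore] -/
theorem sum_coinAt_eq_rowPart {y : Cfg N} {k : ℕ} (h : (pairsAt σ N y k).Nonempty) :
    ∑ src : Fin (N + 1), coinAt σ N y src k = rowPart σ N y k h.some.1 + rowPart σ N y k h.some.2 := by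
  unfold rowPart; rw [← Finset.sum_add_distrib]
  exact Finset.sum_congr rfl fun src _ => coinAt_of_nonempty h src

/-- THE CRUX FUNCTIONAL IN TRACER UNITS: `ipr(Δ) = 9 · (N+1)⁻¹ Σ_i P_i(colls Δ)`. [folklore] -/
theorem ipr_eq_rowPart (y : Cfg N) (Δ : ℝ) :
    ipr σ N y Δ = 9 * (((N + 1 : ℕ) : ℝ)⁻¹ * ∑ i : Fin (N + 1), rowPart σ N y (colls σ N y Δ) i) := by
  rw [ipr_eq_blockMass]
  unfold rowPart; rw [Finset.mul_sum, Finset.mul_sum, Finset.mul_sum]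
  refine Finset.sum_congr rfl fun i _ => ?_
  rw [Finset.mul_sum, Finset.mul_sum, Finset.mul_sum]
  exact Finset.sum_congr rfl fun k _ => by ring

/-- The late coincidence mass through the row participations of the colliding particles:
`lateCoinFr = (N+1)⁻¹ Σ_{late k} (P_{p_k}(k) + P_{q_k}(k))`. [folklore] -/
theorem lateCoinFr_eq_sum_rowPart (y : Cfg N) (Δ : ℝ) (L : ℕ) :
    lateCoinFr σ N y Δ L = ((N + 1 : ℕ) : ℝ)⁻¹ *
      ∑ k ∈ Finset.Ico (colls σ N y ((1 - 1 / (L : ℝ)) * Δ)) (colls σ N y Δ),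
        if h : (pairsAt σ N y k).Nonempty then rowPart σ N y k h.some.1 + rowPart σ N y k h.some.2 else 0 := by
  unfold lateCoinFr; rw [Finset.sum_comm]
  congr 1
  refine Finset.sum_congr rfl fun k _ => ?_
  by_cases h : (pairsAt σ N y k).Nonempty
  · rw [dif_pos h, sum_coinAt_eq_rowPart h]
  · rw [dif_neg h]; exact Finset.sum_eq_zero fun src _ => coinAt_of_not_nonempty h src

/-- **Cauchy–Schwarz for the kinship: `K_pq² ≤ K_pp K_qq`.** [folklore] -/
theorem kinship_sq_le (y : Cfg N) (n : ℕ) (p q : Fin (N + 1)) :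
    kinship σ N y n p q ^ 2 ≤ kinship σ N y n p p * kinship σ N y n q q := by
  unfold kinship
  have h := Finset.sum_mul_sq_le_sq_mul_sq Finset.univ (fun s => blockMass σ N y n p s) (fun s => blockMass σ N y n q s)
  simpa only [sq] using h

/-- The sharper, Cauchy–Schwarz form of the domination: `(Σ_src touchAt)² ≤ 4 P_p P_q`, i.e.
`Σ_src touchAt ≤ 2 √(P_p P_q)` (`≤ P_p + P_q = Σ_src coinAt`). [folklore] -/
theorem sum_touchAt_sq_le {y : Cfg N} {k : ℕ} (h : (pairsAt σ N y k).Nonempty) :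
    (∑ src : Fin (N + 1), touchAt σ N y src k) ^ 2 ≤ 4 * (rowPart σ N y k h.some.1 * rowPart σ N y k h.some.2) := by
  rw [sum_touchAt_eq_kinship h, rowPart_eq_kinship, rowPart_eq_kinship]
  have hcs := kinship_sq_le (σ := σ) y k h.some.1 h.some.2
  nlinarith [hcs]

/-! ### Scale under the row budget -/

/-- Under the row budget `P_i ≤ 1` (`Σ_src (a/3)² ≤ Σ_src (a/3) = 1` as `a ≤ 3`); hence `Σ_src coinAt ≤ 2` per step and
`lateCoinFr ≤ 2·#(late steps)/(N+1) ≍ n_N/L`, the scale of `lateTouchFr`: the domination loses nothing in scale. [folklore] -/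
theorem rowPart_le_one (hRB : RowBudgetN σ) (y : Cfg N) (n : ℕ) (i : Fin (N + 1)) : rowPart σ N y n i ≤ 1 := by
  unfold rowPart
  have h3 : ∑ src : Fin (N + 1), blockMass σ N y n i src / 3 = 1 := by
    rw [← Finset.sum_div, hRB N y n i]; norm_num
  calc ∑ src : Fin (N + 1), (blockMass σ N y n i src / 3) ^ 2 ≤ ∑ src : Fin (N + 1), blockMass σ N y n i src / 3 := by
        refine Finset.sum_le_sum fun src _ => ?_
        have h0 := blockMass_nonneg σ N y n i src
        have h1 := blockMass_le_three hRB y n i src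
        nlinarith
    _ = 1 := h3

end Coin

/-! ## §2 Split mass and the SPLIT-CHARGE identity: late splits are paid by coincidence at the START of the late window -/
section Split

variable (σ : ℝ) (N : ℕ)

/-- SPLIT MASS of the two tracers of source `src` at fold step `k`: `2 f_p (1 − f_p) μ(p)² + 2 f_q (1 − f_q) μ(q)²` at
the reflected pair — the probability that the two tracers sit together on an endpoint of collision `k` and PART there
(one jumps, the other stays); `0` if the step reflects nothing. -/
def splitAt (y : Cfg N) (src : Fin (N + 1)) (k : ℕ) : ℝ :=
  if h : (pairsAt σ N y k).Nonempty then
    2 * shareFrac σ N y k h.some.1 src (unitNormal σ N y k) * (1 - shareFrac σ N y k h.some.1 src (unitNormal σ N y k)) *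
        (blockMass σ N y k h.some.1 src / 3) ^ 2 +
      2 * shareFrac σ N y k h.some.2 src (unitNormal σ N y k) * (1 - shareFrac σ N y k h.some.2 src (unitNormal σ N y k)) *
        (blockMass σ N y k h.some.2 src / 3) ^ 2
  else 0

/-- LATE SPLIT MASS: source-averaged split mass over the late fold steps (the expected number of partings of the two
tracers of a uniform source in the late window). -/
def lateSplitFr (y : Cfg N) (Δ : ℝ) (L : ℕ) : ℝ :=
  ((N + 1 : ℕ) : ℝ)⁻¹ * ∑ src : Fin (N + 1),
    ∑ k ∈ Finset.Ico (colls σ N y ((1 - 1 / (L : ℝ)) * Δ)) (colls σ N y Δ), splitAt σ N y src k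

/-- TOGETHER MASS of the two tracers of source `src` after `n` fold steps: `Σ_i μ_n(i)²`. -/
def together (y : Cfg N) (src : Fin (N + 1)) (n : ℕ) : ℝ :=
  ∑ i : Fin (N + 1), (blockMass σ N y n i src / 3) ^ 2

variable {σ N}

/-- Split masses vanish at steps that reflect nothing. [folklore] -/
theorem splitAt_of_not_nonempty {y : Cfg N} {k : ℕ} (h : ¬ (pairsAt σ N y k).Nonempty) (src : Fin (N + 1)) :
    splitAt σ N y src k = 0 := by
  unfold splitAt; rw [dif_neg h]

/-- Split masses are nonnegative. [folklore] -/
theorem splitAt_nonneg (y : Cfg N) (src : Fin (N + 1)) (k : ℕ) : 0 ≤ splitAt σ N y src k := by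
  unfold splitAt
  by_cases h : (pairsAt σ N y k).Nonempty
  · rw [dif_pos h]
    obtain ⟨hp0, hp1⟩ := shareFrac_unitNormal_mem_Icc (σ := σ) y k h.some.1 src k
    obtain ⟨hq0, hq1⟩ := shareFrac_unitNormal_mem_Icc (σ := σ) y k h.some.2 src k
    have := mul_nonneg (mul_nonneg hp0 (sub_nonneg.2 hp1)) (sq_nonneg (blockMass σ N y k h.some.1 src / 3))
    have := mul_nonneg (mul_nonneg hq0 (sub_nonneg.2 hq1)) (sq_nonneg (blockMass σ N y k h.some.2 src / 3))
    nlinarith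
  · rw [dif_neg h]

/-- The together mass is nonnegative. [folklore] -/
theorem together_nonneg (y : Cfg N) (src : Fin (N + 1)) (n : ℕ) : 0 ≤ together σ N y src n :=
  Finset.sum_nonneg fun _ _ => sq_nonneg _

/-- Source average of the together mass = particle average of the row participation (swap the sums):
`(N+1)⁻¹ Σ_src together(src, n) = (N+1)⁻¹ Σ_i P_i(n)`; at `n = colls Δ'` this is `ipr(Δ')/9`. [folklore] -/
theorem sum_together_eq_sum_rowPart (y : Cfg N) (n : ℕ) :
    ∑ src : Fin (N + 1), together σ N y src n = ∑ i : Fin (N + 1), rowPart σ N y n i := by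
  unfold together rowPart
  rw [Finset.sum_comm]

/-- The source-averaged together mass at `n = colls Δ'` is `ipr(Δ')/9`. [folklore] -/
theorem avg_together_eq_ipr (y : Cfg N) (Δ' : ℝ) :
    ((N + 1 : ℕ) : ℝ)⁻¹ * ∑ src : Fin (N + 1), together σ N y src (colls σ N y Δ') = ipr σ N y Δ' / 9 := by
  rw [sum_together_eq_sum_rowPart, ipr_eq_rowPart]
  ring

/-- **THE SPLIT-CHARGE IDENTITY, one step** (exact two-tracer bookkeeping from the exchange rule): the together mass
moves by `− splitAt + mergeAt` at every fold step. [folklore] -/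
theorem together_succ (y : Cfg N) (src : Fin (N + 1)) (k : ℕ) :
    together σ N y src (k + 1) = together σ N y src k - splitAt σ N y src k + mergeAt σ N y src k := by
  -- the tracer law of the source, in the `OnePath` vocabulary
  set C : OnePath.Src N := ⟨σ, y, 0, 0, 0, 0, src⟩ with hC
  have hmu : ∀ n i, OnePath.mu C n i = blockMass σ N y n i src / 3 := fun n i => rfl
  have htog : ∀ n, together σ N y src n = ∑ i, OnePath.mu C n i ^ 2 := fun n => by
    unfold together; simp_rw [hmu]
  by_cases h : (pairsAt σ N y k).Nonempty
  · have hpq := some_fst_ne_some_snd h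
    have hstep := OnePath.sum_twoPoint hpq (fun i => OnePath.mu C k i ^ 2) (fun i => OnePath.mu C (k + 1) i ^ 2)
      (OnePath.mu C (k + 1) h.some.1 ^ 2) (OnePath.mu C (k + 1) h.some.2 ^ 2) (fun i => by
        by_cases hp : i = h.some.1
        · rw [if_pos hp, hp]
        by_cases hq : i = h.some.2
        · rw [if_neg hp, if_pos hq, hq]
        rw [if_neg hp, if_neg hq, OnePath.mu_succ_of_ne (C := C) (fun _ => ⟨hp, hq⟩)])
    have hp' := OnePath.mu_succ_fst (C := C) h
    have hq' := OnePath.mu_succ_snd (C := C) h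
    have hm : mergeAt σ N y src k = 2 * OnePath.mu C k h.some.1 * OnePath.mu C k h.some.2 *
        (OnePath.fr C k h.some.1 * (1 - OnePath.fr C k h.some.2) +
          OnePath.fr C k h.some.2 * (1 - OnePath.fr C k h.some.1)) := OnePath.mergeAt_eq (C := C) h
    have hs : splitAt σ N y src k =
        2 * OnePath.fr C k h.some.1 * (1 - OnePath.fr C k h.some.1) * OnePath.mu C k h.some.1 ^ 2 +
          2 * OnePath.fr C k h.some.2 * (1 - OnePath.fr C k h.some.2) * OnePath.mu C k h.some.2 ^ 2 := by
      unfold splitAt; rw [dif_pos h]; rfl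
    rw [htog, htog, hstep, hp', hq', hm, hs]
    ring
  · have hmi : ∀ i, OnePath.mu C (k + 1) i = OnePath.mu C k i := fun i =>
      OnePath.mu_succ_of_ne (C := C) (fun h' => absurd h' h)
    rw [htog, htog, splitAt_of_not_nonempty h, mergeAt_of_not_nonempty h]
    simp [hmi]

/-- **THE SPLIT-CHARGE IDENTITY, telescoped**: over any stretch of fold steps `[n₀, n₁)`, the split mass equals the
loss of together mass plus the merge mass. [folklore] -/
theorem sum_splitAt_eq (y : Cfg N) (src : Fin (N + 1)) {n₀ n₁ : ℕ} (h : n₀ ≤ n₁) :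
    ∑ k ∈ Finset.Ico n₀ n₁, splitAt σ N y src k =
      together σ N y src n₀ - together σ N y src n₁ + ∑ k ∈ Finset.Ico n₀ n₁, mergeAt σ N y src k := by
  induction n₁, h using Nat.le_induction with
  | base => simp
  | succ n₁ hn ih =>
    rw [Finset.sum_Ico_succ_top hn, Finset.sum_Ico_succ_top hn, ih, together_succ]
    ring

/-- **LATE SPLITS ARE CHARGED TO COINCIDENCE AT THE START OF THE LATE WINDOW PLUS LATE MERGES**:
`lateSplitFr(Δ, L) ≤ ipr((1 − 1/L)Δ)/9 + lateMergeFr(Δ, L)` for every configuration (the junk case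
`colls((1 − 1/L)Δ) > colls Δ` has empty late window). The crux functional enters at the EARLIER depth `(1 − 1/L)Δ` —
an admissible window again — and WITHOUT a rate. [folklore] -/
theorem lateSplitFr_le (y : Cfg N) (Δ : ℝ) (L : ℕ) :
    lateSplitFr σ N y Δ L ≤ ipr σ N y ((1 - 1 / (L : ℝ)) * Δ) / 9 + lateMergeFr σ N y Δ L := by
  have hN : (0 : ℝ) ≤ ((N + 1 : ℕ) : ℝ)⁻¹ := inv_nonneg.2 (by positivity)
  rw [← avg_together_eq_ipr]
  unfold lateSplitFr lateMergeFr
  rw [← mul_add, ← Finset.sum_add_distrib]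
  refine mul_le_mul_of_nonneg_left (Finset.sum_le_sum fun src _ => ?_) hN
  set n₀ := colls σ N y ((1 - 1 / (L : ℝ)) * Δ)
  set n₁ := colls σ N y Δ
  by_cases h : n₀ ≤ n₁
  · rw [sum_splitAt_eq y src h]
    linarith [together_nonneg (σ := σ) y src n₁]
  · rw [Finset.Ico_eq_empty (fun h' => h (Nat.le_of_lt h')), Finset.sum_empty, Finset.sum_empty, add_zero]
    exact together_nonneg y src n₀

/-- The same with contacts: `lateSplitFr ≤ ipr((1 − 1/L)Δ)/9 + lateTouchFr`. [folklore] -/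
theorem lateSplitFr_le_touch (y : Cfg N) (Δ : ℝ) (L : ℕ) :
    lateSplitFr σ N y Δ L ≤ ipr σ N y ((1 - 1 / (L : ℝ)) * Δ) / 9 + lateTouchFr σ N y Δ L :=
  (lateSplitFr_le y Δ L).trans (by linarith [lateMergeFr_le_lateTouchFr (σ := σ) y Δ L])

/-- Late split masses are nonnegative. [folklore] -/
theorem lateSplitFr_nonneg (y : Cfg N) (Δ : ℝ) (L : ℕ) : 0 ≤ lateSplitFr σ N y Δ L := by
  unfold lateSplitFr
  exact mul_nonneg (inv_nonneg.2 (by positivity)) (Finset.sum_nonneg fun s _ => Finset.sum_nonneg fun k _ => splitAt_nonneg y s k)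

end Split

/-! ## §3 The RATE statement the stub follows from, and the reduction -/

/-- LATE COINCIDENT COLLISIONS ARE RARE (at fixed `(σ, profiles, flow family)`): `LateTouchRareAt` with the contact
mass `lateTouchFr` replaced by the coincidence mass `lateCoinFr = (N+1)⁻¹ Σ_{late k} (P_{p_k}(k) + P_{q_k}(k))` — along
the local-Gibbs-evolved law, for every admissible window, `t > 0`, `ε > 0` there is `L ≥ 1` such that eventually the
expected number of late collisions hitting the common host of the two tracers of a uniform source is `≤ ε`. Since every
particle suffers `≍ n_N/L → ∞` late collisions and `P_i` is the row participation `/9`, this is the crux's own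
functional SUMMED over the late window: a RATE form of `DiffuseBackwardInfluence` (`≈ (n_N/L) · E[ipr_late]/9 → 0`,
true iff roughly `E[ipr](n) = O(9/n)` collisions-per-particle deep, uniformly in `N`; predicted by the transient-return
law `E[ipr] ≈ 9(Ae^{−cn} + Bσ⁶n^{−3/2}) + O(9/N)` of card `coalescing-influence-tracers`, but STRONGER than the crux). -/
def LateCoinRareAt (σ : ℝ) (a₀ θ₀ : T3 → ℝ) (u₀ : T3 → V3) (Φ : (N : ℕ) → Flow σ N) : Prop :=
  ∀ Δ : ℕ → ℝ, (∀ N, 0 < Δ N) → Tendsto Δ atTop (𝓝 0) →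
    Tendsto (fun N : ℕ => Δ N * ((N + 1 : ℕ) : ℝ) ^ ((1 : ℝ) / 3)) atTop atTop →
    ∀ t : ℝ, 0 < t → ∀ ε : ℝ, 0 < ε → ∃ L : ℕ, 1 ≤ L ∧
      ∀ᶠ N : ℕ in atTop,
        ∫⁻ z, ENNReal.ofReal (lateCoinFr σ N ((Φ N).flow (t - Δ N) z) (Δ N) L)
            ∂(localGibbsLaw σ a₀ u₀ θ₀ N (Φ N)) ≤ ENNReal.ofReal ε

/-- `LateCoinRareAt` quantified as the stub (`∀ profiles, ∃ σ₀, ∀ σ < σ₀, ∀ Φ`). -/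
def LateCoinRare : Prop :=
  ∀ (a₀ θ₀ : T3 → ℝ) (u₀ : T3 → V3), Continuous a₀ → Continuous θ₀ → Continuous u₀ →
    (∀ x, 0 < a₀ x) → (∀ x, 0 < θ₀ x) → ∃ σ₀ : ℝ, 0 < σ₀ ∧ ∀ σ : ℝ, 0 < σ → σ < σ₀ →
    ∀ Φ : (N : ℕ) → Flow σ N, LateCoinRareAt σ a₀ θ₀ u₀ Φ

/-- `LateCoinRareAt ⇒ LateTouchRareAt` at every fixed `(σ, profiles, flow family)` (same `L`; monotonicity of the outer
integral, no measurability needed). [folklore] -/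
theorem lateTouchRareAt_of_lateCoinRareAt {σ : ℝ} {a₀ θ₀ : T3 → ℝ} {u₀ : T3 → V3} {Φ : (N : ℕ) → Flow σ N}
    (h : LateCoinRareAt σ a₀ θ₀ u₀ Φ) : LateTouchRareAt σ a₀ θ₀ u₀ Φ := by
  intro Δ hΔp hΔ0 hΔg t ht ε hε
  obtain ⟨L, hL1, hL⟩ := h Δ hΔp hΔ0 hΔg t ht ε hε
  refine ⟨L, hL1, hL.mono fun N hN => le_trans (lintegral_mono fun z => ?_) hN⟩
  exact ENNReal.ofReal_le_ofReal (lateTouchFr_le_lateCoinFr _ _ _)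

/-- `LateCoinRare ⇒ LateTouchRare` (the stub's statement verbatim, same `σ₀`). [folklore] -/
theorem lateTouchRare_of_lateCoinRare (h : LateCoinRare) : LateTouchRare := by
  intro a₀ θ₀ u₀ ha hθ hu ha0 hθ0
  obtain ⟨σ₀, hσ₀, H⟩ := h a₀ θ₀ u₀ ha hθ hu ha0 hθ0
  exact ⟨σ₀, hσ₀, fun σ hσ hσlt Φ => lateTouchRareAt_of_lateCoinRareAt (H σ hσ hσlt Φ)⟩

/-- THE BOOTSTRAP CLOSES (fixed-point form, for the reshaped composition): a FINITE quantity `Λ` with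
`Λ ≤ a + c Λ`, `c < 1`, satisfies `Λ ≤ a / (1 − c)`. Used with `Λ := sup over admissible windows of limsup_N E[ipr]`
(`≤ 9` by the row budget), `c ≍ r(σ) < 1` for `σ < σ₀` — the one place smallness of `σ` is load-bearing — and
`a` = one-path smallness + fresh late contacts. [folklore] -/
theorem bootstrap_le {Λ a c : ℝ} (hc1 : c < 1) (h : Λ ≤ a + c * Λ) : Λ ≤ a / (1 - c) := by
  rw [le_div_iff₀ (sub_pos.2 hc1)]
  nlinarith

end LateMerges

/-- **REGISTERED SUB-GOAL (helper of `stub_lateTouchRare`) — the stub follows from the RATE statement:**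
`LateCoinRareAt ⇒ LateTouchRareAt` at every fixed `(σ, profiles, flow family)` (`touchAt ≤ coinAt` by AM–GM,
monotonicity of the outer integral; no row budget, no measurability). [folklore] -/
theorem lateTouchRare_of_lateCoinRareAt : ∀ (σ : ℝ) (a₀ θ₀ : T3 → ℝ) (u₀ : T3 → V3) (Φ : (N : ℕ) → Flow σ N), LateMerges.LateCoinRareAt σ a₀ θ₀ u₀ Φ → LateMerges.LateTouchRareAt σ a₀ θ₀ u₀ Φ :=
  fun _ _ _ _ _ h => LateMerges.lateTouchRareAt_of_lateCoinRareAt h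

/-- **REGISTERED SUB-GOAL (helper of `stub_lateTouchRare`) — THE SPLIT CHARGE:** for every configuration, window and
`L`, the late split mass of the two tracers of a uniform source is at most the crux functional at the EARLIER depth
`(1 − 1/L)Δ` (over `9`) plus the late contact mass: `lateSplitFr(Δ, L) ≤ ipr((1 − 1/L)Δ)/9 + lateTouchFr(Δ, L)`
(exact two-tracer bookkeeping `Δ together = −split + merge`, telescoped; `merge ≤ touch`). The pathwise half of the
renewal bootstrap that replaces the stub. [folklore] -/
theorem lateSplit_charge : ∀ (σ : ℝ) (N : ℕ) (y : Cfg N) (Δ : ℝ) (L : ℕ), LateMerges.lateSplitFr σ N y Δ L ≤ ipr σ N y ((1 - 1 / (L : ℝ)) * Δ) / 9 + LateMerges.lateTouchFr σ N y Δ L :=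
  fun _ _ y Δ L => LateMerges.lateSplitFr_le_touch y Δ L

end

end Summit.AtomisticToContinuum.HydrodynamicLimit.Theorems.DiffuseBackwardInfluenceShare
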